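import Mathlib
import HarnessLib
import Literature.MathematicalPhysics.AQFT.OSAxiomsSchwinger

/-!
# `CurvatureKernelBound` — stub A1 support: two-point tensors, slots, supports and OS witnesses

Support file for crux `stmt-QuantumFields-11687` (`PencilRigidity.CurvatureKernelBound`), line
`sixteen-charts-analytic-kernel`, stub `ChartDerivativeBounds` (A1).  Def-free bookkeeping for the
tree's tensors `SchwartzMap.tensorFin 2 ![f, g]` and one-point lifts `SchwartzMap.tensorFin 1 ![φ]`:

* evaluation, scalars and zero in each slot; translations (`compSubConstCLM`) and line derivatives
  (`LineDeriv.lineDerivOp`, iterated) acting on one slot (`compSubConstCLM_single_one_tensorFin_two`,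
  `iterate_lineDerivOp_single_one_tensorFin_two`, …); `(∂_{-v})^[j] = (−1)ʲ (∂_v)^[j]`;
* supports: translates, iterated line derivatives, `conj ∘ f ∘ θ`;
* the OS side at time direction `e₀`: `isTimeOrdered_tensorFin_one` and the tensor witnesses
  `isAppendTensorOf_conjTheta_translate_right/left` identifying
  `Θ(φ-lift)* ⊗ (χ-lift)(· − a)` and `Θ((φ-lift)(· − a))* ⊗ χ-lift` with two-point tensors
  (registered sub-goal `ConjThetaTensorWitness`).
[folklore]
-/

noncomputable section

open scoped SchwartzMap LineDeriv ComplexConjugate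
open Filter Set
open Literature.MathematicalPhysics.AQFT Literature.MathematicalPhysics.QuantumLattice

namespace Summit.QuantumFields.YangMills.Theorems.CurvatureKernel

/-! ## Two-point tensors over a general space -/

section Generic

variable {E : Type*} [NormedAddCommGroup E] [NormedSpace ℝ E]

/-- `(f ⊗ g)(x) = f(x₀) g(x₁)`. [folklore] -/
theorem tensorFin_two_eval (f g : 𝓢(E, ℂ)) (x : Fin 2 → E) :
    SchwartzMap.tensorFin 2 ![f, g] x = f (x 0) * g (x 1) := by
  simp [Fin.prod_univ_two]

/-- `(φ-lift)(x) = φ(x₀)`. [folklore] -/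
theorem tensorFin_one_eval (φ : 𝓢(E, ℂ)) (x : Fin 1 → E) :
    SchwartzMap.tensorFin 1 ![φ] x = φ (x 0) := by
  simp

/-- Scalars in the first slot. [folklore] -/
theorem tensorFin_two_smul_left (c : ℂ) (f g : 𝓢(E, ℂ)) :
    SchwartzMap.tensorFin 2 ![c • f, g] = c • SchwartzMap.tensorFin 2 ![f, g] := by
  ext x
  simp only [tensorFin_two_eval, smul_apply, smul_eq_mul]
  ring

/-- Scalars in the second slot. [folklore] -/
theorem tensorFin_two_smul_right (c : ℂ) (f g : 𝓢(E, ℂ)) :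
    SchwartzMap.tensorFin 2 ![f, c • g] = c • SchwartzMap.tensorFin 2 ![f, g] := by
  ext x
  simp only [tensorFin_two_eval, smul_apply, smul_eq_mul]
  ring

/-- Zero in the first slot. [folklore] -/
theorem tensorFin_two_zero_left (g : 𝓢(E, ℂ)) :
    SchwartzMap.tensorFin 2 ![(0 : 𝓢(E, ℂ)), g] = 0 := by
  ext x
  simp

/-- Zero in the second slot. [folklore] -/
theorem tensorFin_two_zero_right (f : 𝓢(E, ℂ)) :
    SchwartzMap.tensorFin 2 ![f, (0 : 𝓢(E, ℂ))] = 0 := by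
  ext x
  simp

/-- Translating the second slot: `(f ⊗ g)(· − (0, a)) = f ⊗ g(· − a)`. [folklore] -/
theorem compSubConstCLM_single_one_tensorFin_two (a : E) (f g : 𝓢(E, ℂ)) :
    SchwartzMap.compSubConstCLM ℂ (Pi.single 1 a : Fin 2 → E) (SchwartzMap.tensorFin 2 ![f, g]) =
      SchwartzMap.tensorFin 2 ![f, SchwartzMap.compSubConstCLM ℂ a g] := by
  ext x
  simp [SchwartzMap.compSubConstCLM_apply]

/-- Translating the first slot: `(f ⊗ g)(· − (a, 0)) = f(· − a) ⊗ g`. [folklore] -/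
theorem compSubConstCLM_single_zero_tensorFin_two (a : E) (f g : 𝓢(E, ℂ)) :
    SchwartzMap.compSubConstCLM ℂ (Pi.single 0 a : Fin 2 → E) (SchwartzMap.tensorFin 2 ![f, g]) =
      SchwartzMap.tensorFin 2 ![SchwartzMap.compSubConstCLM ℂ a f, g] := by
  ext x
  simp [SchwartzMap.compSubConstCLM_apply]

/-- Diagonal translation: `(f ⊗ g)_{(a,1)} = f(· − a) ⊗ g(· − a)`. [folklore] -/
theorem translateMulti_tensorFin_two (a : E) (f g : 𝓢(E, ℂ)) :
    translateMulti a (SchwartzMap.tensorFin 2 ![f, g]) =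
      SchwartzMap.tensorFin 2 ![SchwartzMap.compSubConstCLM ℂ a f, SchwartzMap.compSubConstCLM ℂ a g] := by
  ext x
  simp [SchwartzMap.compSubConstCLM_apply]

/-- The derivative of `f ⊗ g`. [folklore] -/
theorem hasFDerivAt_tensorFin_two (f g : 𝓢(E, ℂ)) (x : Fin 2 → E) :
    HasFDerivAt (SchwartzMap.tensorFin 2 ![f, g] : (Fin 2 → E) → ℂ)
      (f (x 0) • ((fderiv ℝ g (x 1)).comp (ContinuousLinearMap.proj (R := ℝ) (1 : Fin 2))) +
        g (x 1) • ((fderiv ℝ f (x 0)).comp (ContinuousLinearMap.proj (R := ℝ) (0 : Fin 2)))) x := by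
  have hfun : (SchwartzMap.tensorFin 2 ![f, g] : (Fin 2 → E) → ℂ) = fun x => f (x 0) * g (x 1) :=
    funext (tensorFin_two_eval f g)
  rw [hfun]
  have h0 : HasFDerivAt (fun x : Fin 2 → E => f (x 0))
      ((fderiv ℝ f (x 0)).comp (ContinuousLinearMap.proj (R := ℝ) (0 : Fin 2))) x :=
    (f.hasFDerivAt (x 0)).comp x
      (ContinuousLinearMap.proj (R := ℝ) (0 : Fin 2) : (Fin 2 → E) →L[ℝ] E).hasFDerivAt
  have h1 : HasFDerivAt (fun x : Fin 2 → E => g (x 1))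
      ((fderiv ℝ g (x 1)).comp (ContinuousLinearMap.proj (R := ℝ) (1 : Fin 2))) x :=
    (g.hasFDerivAt (x 1)).comp x
      (ContinuousLinearMap.proj (R := ℝ) (1 : Fin 2) : (Fin 2 → E) →L[ℝ] E).hasFDerivAt
  exact h0.mul h1

/-- **Directions in the second slot fall on the second factor**: `∂_{(0,v)}(f ⊗ g) = f ⊗ ∂_v g`. [folklore] -/
theorem lineDerivOp_single_one_tensorFin_two (v : E) (f g : 𝓢(E, ℂ)) :
    (∂_{(Pi.single 1 v : Fin 2 → E)} (SchwartzMap.tensorFin 2 ![f, g]) : 𝓢((Fin 2 → E), ℂ)) =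
      SchwartzMap.tensorFin 2 ![f, ∂_{v} g] := by
  ext x
  rw [SchwartzMap.lineDerivOp_apply_eq_fderiv, (hasFDerivAt_tensorFin_two f g x).fderiv,
    tensorFin_two_eval, SchwartzMap.lineDerivOp_apply_eq_fderiv]
  simp

/-- **Directions in the first slot fall on the first factor**: `∂_{(v,0)}(f ⊗ g) = ∂_v f ⊗ g`. [folklore] -/
theorem lineDerivOp_single_zero_tensorFin_two (v : E) (f g : 𝓢(E, ℂ)) :
    (∂_{(Pi.single 0 v : Fin 2 → E)} (SchwartzMap.tensorFin 2 ![f, g]) : 𝓢((Fin 2 → E), ℂ)) =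
      SchwartzMap.tensorFin 2 ![∂_{v} f, g] := by
  ext x
  rw [SchwartzMap.lineDerivOp_apply_eq_fderiv, (hasFDerivAt_tensorFin_two f g x).fderiv,
    tensorFin_two_eval, SchwartzMap.lineDerivOp_apply_eq_fderiv]
  simp [mul_comm]

/-- Iterated form: `(∂_{(0,v)})^[j] (f ⊗ g) = f ⊗ (∂_v)^[j] g`. [folklore] -/
theorem iterate_lineDerivOp_single_one_tensorFin_two (v : E) (j : ℕ) (f g : 𝓢(E, ℂ)) :
    ((∂_{(Pi.single 1 v : Fin 2 → E)} : 𝓢((Fin 2 → E), ℂ) → 𝓢((Fin 2 → E), ℂ))^[j]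
        (SchwartzMap.tensorFin 2 ![f, g])) =
      SchwartzMap.tensorFin 2 ![f, ((∂_{v} : 𝓢(E, ℂ) → 𝓢(E, ℂ))^[j] g)] := by
  induction j with
  | zero => rfl
  | succ j ih =>
    rw [Function.iterate_succ_apply', ih, lineDerivOp_single_one_tensorFin_two,
      Function.iterate_succ_apply']

/-- Iterated form: `(∂_{(v,0)})^[j] (f ⊗ g) = (∂_v)^[j] f ⊗ g`. [folklore] -/
theorem iterate_lineDerivOp_single_zero_tensorFin_two (v : E) (j : ℕ) (f g : 𝓢(E, ℂ)) :
    ((∂_{(Pi.single 0 v : Fin 2 → E)} : 𝓢((Fin 2 → E), ℂ) → 𝓢((Fin 2 → E), ℂ))^[j]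
        (SchwartzMap.tensorFin 2 ![f, g])) =
      SchwartzMap.tensorFin 2 ![((∂_{v} : 𝓢(E, ℂ) → 𝓢(E, ℂ))^[j] f), g] := by
  induction j with
  | zero => rfl
  | succ j ih =>
    rw [Function.iterate_succ_apply', ih, lineDerivOp_single_zero_tensorFin_two,
      Function.iterate_succ_apply']

/-- Opposite direction: `(∂_{-v})^[j] Y = (−1)ʲ (∂_v)^[j] Y`. [folklore] -/
theorem iterate_lineDerivOp_neg {V : Type*} [NormedAddCommGroup V] [NormedSpace ℝ V] (v : V) (j : ℕ)
    (Y : 𝓢(V, ℂ)) :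
    ((∂_{-v} : 𝓢(V, ℂ) → 𝓢(V, ℂ))^[j] Y) = (-1 : ℂ) ^ j • ((∂_{v} : 𝓢(V, ℂ) → 𝓢(V, ℂ))^[j] Y) := by
  induction j with
  | zero => simp
  | succ j ih =>
    rw [Function.iterate_succ_apply', ih, LineDeriv.lineDerivOp_smul, LineDeriv.lineDerivOp_left_neg,
      Function.iterate_succ_apply', smul_neg, pow_succ, mul_comm, ← smul_smul, neg_one_smul]

/-- Scalars pass through iterated line derivatives. [folklore] -/
theorem iterate_lineDerivOp_smul {V : Type*} [NormedAddCommGroup V] [NormedSpace ℝ V] (v : V) (j : ℕ)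
    (c : ℂ) (Y : 𝓢(V, ℂ)) :
    ((∂_{v} : 𝓢(V, ℂ) → 𝓢(V, ℂ))^[j] (c • Y)) = c • ((∂_{v} : 𝓢(V, ℂ) → 𝓢(V, ℂ))^[j] Y) := by
  rw [← LineDeriv.iteratedLineDerivOp_const_eq_iter_lineDerivOp,
    ← LineDeriv.iteratedLineDerivOp_const_eq_iter_lineDerivOp, LineDeriv.iteratedLineDerivOp_smul]

/-! ### Supports -/

/-- The support of an iterated line derivative lies in the support. [folklore] -/
theorem tsupport_iterate_lineDerivOp_subset {V : Type*} [NormedAddCommGroup V] [NormedSpace ℝ V]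
    (v : V) (j : ℕ) (Y : 𝓢(V, ℂ)) :
    tsupport (((∂_{v} : 𝓢(V, ℂ) → 𝓢(V, ℂ))^[j] Y : 𝓢(V, ℂ)) : V → ℂ) ⊆ tsupport (Y : V → ℂ) := by
  rw [← LineDeriv.iteratedLineDerivOp_const_eq_iter_lineDerivOp]
  exact SchwartzMap.tsupport_iteratedLineDerivOp_subset _ Y

/-- The support of a translate: `x ∈ tsupport f(· − a) → x − a ∈ tsupport f`. [folklore] -/
theorem sub_mem_tsupport_of_mem_tsupport_compSubConstCLM {V : Type*} [NormedAddCommGroup V]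
    [NormedSpace ℝ V] (a : V) (Y : 𝓢(V, ℂ)) {x : V}
    (hx : x ∈ tsupport ((SchwartzMap.compSubConstCLM ℂ a Y : 𝓢(V, ℂ)) : V → ℂ)) :
    x - a ∈ tsupport (Y : V → ℂ) := by
  have h : ((SchwartzMap.compSubConstCLM ℂ a Y : 𝓢(V, ℂ)) : V → ℂ) = (Y : V → ℂ) ∘ fun x => x - a :=
    rfl
  rw [h] at hx
  exact tsupport_comp_subset_preimage (Y : V → ℂ) (continuous_sub_right a) hx

/-- Scalars and single directions: `t • (0,…,v,…,0) = (0,…,t v,…,0)`. [folklore] -/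
theorem smul_pi_single_fin_two (t : ℝ) (i : Fin 2) (v : E) :
    t • (Pi.single i v : Fin 2 → E) = Pi.single i (t • v) :=
  (Pi.single_smul' i t v).symm

/-- **Disjoint supports ⇒ `f ⊗ g ∈ ⁰𝒮`.** [folklore] -/
theorem isOffDiagonal_tensorFin_two_of_disjoint {f g : 𝓢(E, ℂ)}
    (h : Disjoint (tsupport (f : E → ℂ)) (tsupport (g : E → ℂ))) :
    IsOffDiagonal (SchwartzMap.tensorFin 2 ![f, g]) := by
  have hS : IsClosed {x : Fin 2 → E | x 0 ∈ tsupport (f : E → ℂ) ∧ x 1 ∈ tsupport (g : E → ℂ)} :=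
    ((isClosed_tsupport _).preimage (continuous_apply 0)).inter
      ((isClosed_tsupport _).preimage (continuous_apply 1))
  have hsub : tsupport (SchwartzMap.tensorFin 2 ![f, g] : (Fin 2 → E) → ℂ) ⊆
      {x | x 0 ∈ tsupport (f : E → ℂ) ∧ x 1 ∈ tsupport (g : E → ℂ)} := by
    refine closure_minimal (fun x hx => ?_) hS
    rw [Function.mem_support, tensorFin_two_eval] at hx
    obtain ⟨hf, hg⟩ := mul_ne_zero_iff.1 hx
    exact ⟨subset_tsupport _ hf, subset_tsupport _ hg⟩
  refine IsOffDiagonal.of_tsupport_subset fun x hx hloc => ?_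
  obtain ⟨hf, hg⟩ := hsub hx
  obtain ⟨i, j, hij, hxij⟩ := hloc
  have h01 : x 0 = x 1 := by
    fin_cases i <;> fin_cases j
    · exact absurd rfl hij
    · exact hxij
    · exact hxij.symm
    · exact absurd rfl hij
  rw [h01] at hf
  exact Set.disjoint_left.1 h hf hg

end Generic

/-! ## The OS side: time ordering and tensor witnesses at time direction `e₀` -/

section Euclid

variable {d : ℕ} [NeZero d]

/-- `(conj ∘ φ ∘ θ)(y) = conj φ(θy)`. [folklore] -/
theorem starTest_thetaTest_apply (φ : 𝓢(EuclideanSpace ℝ (Fin d), ℂ)) (y : EuclideanSpace ℝ (Fin d)) :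
    starTest (thetaTest d φ) y = conj (φ (timeReflection d y)) := by
  simp

/-- `conj ∘ (conj ∘ φ ∘ θ) ∘ θ = φ`. [folklore] -/
theorem starTest_thetaTest_starTest_thetaTest (φ : 𝓢(EuclideanSpace ℝ (Fin d), ℂ)) :
    starTest (thetaTest d (starTest (thetaTest d φ))) = φ := by
  ext y
  simp [timeReflection_timeReflection]

/-- The support of `conj ∘ φ ∘ θ` is the reflected support. [folklore] -/
theorem timeReflection_mem_tsupport_of_mem_tsupport_starTest_thetaTest
    (φ : 𝓢(EuclideanSpace ℝ (Fin d), ℂ)) {y : EuclideanSpace ℝ (Fin d)}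
    (hy : y ∈ tsupport ((starTest (thetaTest d φ) : 𝓢(EuclideanSpace ℝ (Fin d), ℂ)) :
      EuclideanSpace ℝ (Fin d) → ℂ)) :
    timeReflection d y ∈ tsupport (φ : EuclideanSpace ℝ (Fin d) → ℂ) := by
  have h : ((starTest (thetaTest d φ) : 𝓢(EuclideanSpace ℝ (Fin d), ℂ)) : EuclideanSpace ℝ (Fin d) → ℂ) =
      (fun z : ℂ => conj z) ∘ ((φ : EuclideanSpace ℝ (Fin d) → ℂ) ∘ timeReflection d) := by
    funext z; simp
  rw [h] at hy
  have h1 := tsupport_comp_subset (g := fun z : ℂ => conj z) (map_zero _)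
    ((φ : EuclideanSpace ℝ (Fin d) → ℂ) ∘ timeReflection d) hy
  exact tsupport_comp_subset_preimage (φ : EuclideanSpace ℝ (Fin d) → ℂ)
    (timeReflection d).continuous h1

/-- **Negative-time functions reflect to positive-time functions**:
`supp f ⊆ {y₀ < 0} ⇒ supp (conj ∘ f ∘ θ) ⊆ {y₀ > 0}`. [folklore] -/
theorem tsupport_starTest_thetaTest_subset_pos {f : 𝓢(EuclideanSpace ℝ (Fin d), ℂ)}
    (hf : tsupport (f : EuclideanSpace ℝ (Fin d) → ℂ) ⊆ {y | y 0 < 0}) :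
    tsupport ((starTest (thetaTest d f) : 𝓢(EuclideanSpace ℝ (Fin d), ℂ)) :
      EuclideanSpace ℝ (Fin d) → ℂ) ⊆ {y | 0 < y 0} := by
  intro y hy
  have h := hf (timeReflection_mem_tsupport_of_mem_tsupport_starTest_thetaTest f hy)
  simp only [mem_setOf_eq, timeReflection_apply, if_true, neg_lt_zero] at h
  exact h

/-- **A positive-time one-point function lifts to a time-ordered degree-one test function.** [folklore] -/
theorem isTimeOrdered_tensorFin_one {φ : 𝓢(EuclideanSpace ℝ (Fin d), ℂ)}
    (hφ : tsupport (φ : EuclideanSpace ℝ (Fin d) → ℂ) ⊆ {y | 0 < y 0}) :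
    IsTimeOrdered (SchwartzMap.tensorFin 1 ![φ]) := by
  intro x hx
  have hK : IsClosed ((fun x : Fin 1 → EuclideanSpace ℝ (Fin d) => x 0) ⁻¹'
      tsupport (φ : EuclideanSpace ℝ (Fin d) → ℂ)) :=
    (isClosed_tsupport _).preimage (continuous_apply 0)
  have hsub : Function.support (SchwartzMap.tensorFin 1 ![φ] : (Fin 1 → EuclideanSpace ℝ (Fin d)) → ℂ) ⊆
      (fun x : Fin 1 → EuclideanSpace ℝ (Fin d) => x 0) ⁻¹' tsupport (φ : EuclideanSpace ℝ (Fin d) → ℂ) := by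
    intro y hy
    rw [Function.mem_support, tensorFin_one_eval] at hy
    exact subset_tsupport _ (Function.mem_support.2 hy)
  have h0 : 0 < x 0 0 := hφ (closure_minimal hsub hK hx)
  refine ⟨fun i => by rw [Subsingleton.elim i 0]; exact h0, fun i j hij => ?_⟩
  exact absurd (Subsingleton.elim i j) (ne_of_lt hij)

/-- The OS adjoint of a one-point lift: `Θ(φ-lift)*(x) = conj φ(θx₀)`. [folklore] -/
theorem osAdjoint_tensorFin_one_apply (φ : 𝓢(EuclideanSpace ℝ (Fin d), ℂ))
    (x : Fin 1 → EuclideanSpace ℝ (Fin d)) :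
    osAdjoint (SchwartzMap.tensorFin 1 ![φ]) x = conj (φ (timeReflection d (x 0))) := by
  have h : Fin.rev (0 : Fin 1) = 0 := Subsingleton.elim _ _
  rw [osAdjoint_apply, tensorFin_one_eval, h]

/-- The OS adjoint of a translated one-point lift: `Θ((φ-lift)(· − a))*(x) = conj φ(θx₀ − a)`. [folklore] -/
theorem osAdjoint_translateMulti_tensorFin_one_apply (φ : 𝓢(EuclideanSpace ℝ (Fin d), ℂ))
    (a : EuclideanSpace ℝ (Fin d)) (x : Fin 1 → EuclideanSpace ℝ (Fin d)) :
    osAdjoint (translateMulti a (SchwartzMap.tensorFin 1 ![φ])) x =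
      conj (φ (timeReflection d (x 0) - a)) := by
  have h : Fin.rev (0 : Fin 1) = 0 := Subsingleton.elim _ _
  rw [osAdjoint_apply, translateMulti_apply, tensorFin_one_eval, h]

/-- **Tensor witness, second factor translated**: for one-point `φ, χ` and `a`,
`(conj ∘ φ ∘ θ) ⊗ χ(· − a)` witnesses `Θ(φ-lift)* ⊗ (χ-lift)_{(a,1)}`. [folklore] -/
theorem isAppendTensorOf_conjTheta_translate_right (φ χ : 𝓢(EuclideanSpace ℝ (Fin d), ℂ))
    (a : EuclideanSpace ℝ (Fin d)) :
    IsAppendTensorOf (SchwartzMap.tensorFin 2 ![starTest (thetaTest d φ), SchwartzMap.compSubConstCLM ℂ a χ])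
      (osAdjoint (SchwartzMap.tensorFin 1 ![φ])) (translateMulti a (SchwartzMap.tensorFin 1 ![χ])) := by
  intro x
  rw [osAdjoint_tensorFin_one_apply, translateMulti_apply, tensorFin_one_eval, tensorFin_two_eval]
  simp [SchwartzMap.compSubConstCLM_apply]

/-- **Tensor witness, first factor translated**: for one-point `φ, χ` and `a`,
`(conj ∘ φ ∘ θ)(· − θa) ⊗ χ` witnesses `Θ((φ-lift)_{(a,1)})* ⊗ χ-lift`. [folklore] -/
theorem isAppendTensorOf_conjTheta_translate_left (φ χ : 𝓢(EuclideanSpace ℝ (Fin d), ℂ))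
    (a : EuclideanSpace ℝ (Fin d)) :
    IsAppendTensorOf (SchwartzMap.tensorFin 2
        ![SchwartzMap.compSubConstCLM ℂ (timeReflection d a) (starTest (thetaTest d φ)), χ])
      (osAdjoint (translateMulti a (SchwartzMap.tensorFin 1 ![φ]))) (SchwartzMap.tensorFin 1 ![χ]) := by
  intro x
  rw [osAdjoint_translateMulti_tensorFin_one_apply, tensorFin_one_eval, tensorFin_two_eval]
  simp [SchwartzMap.compSubConstCLM_apply, map_sub, timeReflection_timeReflection]

/-- The time vector `t e₀`: `EuclideanSpace.single 0 t = t • EuclideanSpace.single 0 1`. [folklore] -/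
theorem euclideanSingle_zero_eq_smul (t : ℝ) :
    (EuclideanSpace.single (0 : Fin d) t : EuclideanSpace ℝ (Fin d)) =
      t • EuclideanSpace.single (0 : Fin d) (1 : ℝ) := by
  ext i
  simp

/-- **Tensor witness at equal times**: `(conj ∘ φ ∘ θ) ⊗ χ` witnesses `Θ(φ-lift)* ⊗ χ-lift`, so that
`⟪Ψ_φ, Ψ_χ⟫ = 𝔖₂((conj ∘ φ ∘ θ) ⊗ χ)`. [folklore] -/
theorem isAppendTensorOf_conjTheta (φ χ : 𝓢(EuclideanSpace ℝ (Fin d), ℂ)) :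
    IsAppendTensorOf (SchwartzMap.tensorFin 2 ![starTest (thetaTest d φ), χ])
      (osAdjoint (SchwartzMap.tensorFin 1 ![φ])) (SchwartzMap.tensorFin 1 ![χ]) := by
  intro x
  rw [osAdjoint_tensorFin_one_apply, tensorFin_one_eval, tensorFin_two_eval]
  simp

end Euclid

/-- **Sub-goal `ConjThetaTensorWitness`** (helper for stub `ChartDerivativeBounds`): the two-point
tensor `(conj ∘ φ ∘ θ) ⊗ χ(· − a)` is an OS tensor witness `Θ(φ-lift)* ⊗ (χ-lift)_{(a,1)}`, so that
`⟪Ψ_φ, e^{-tH} Ψ_χ⟫ = 𝔖₂((conj ∘ φ ∘ θ) ⊗ χ(· − t e₀))` in the OS reconstruction. [folklore] -/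
theorem ConjThetaTensorWitness : open Literature.MathematicalPhysics.QuantumLattice in ∀ {d : ℕ} [NeZero d] (φ χ : SchwartzMap (EuclideanSpace ℝ (Fin d)) ℂ) (a : EuclideanSpace ℝ (Fin d)), IsAppendTensorOf (SchwartzMap.tensorFin 2 ![starTest (thetaTest d φ), SchwartzMap.compSubConstCLM ℂ a χ]) (osAdjoint (SchwartzMap.tensorFin 1 ![φ])) (translateMulti a (SchwartzMap.tensorFin 1 ![χ])) := by
  intro d _ φ χ a
  exact isAppendTensorOf_conjTheta_translate_right φ χ a

end Summit.QuantumFields.YangMills.Theorems.CurvatureKernel
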